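import Literature.MathematicalPhysics.QuantumFieldTheory.Balaban1983to89.B5Hk163Form166
import Literature.MathematicalPhysics.QuantumFieldTheory.Balaban1983to89.B5Kernel166Decay
import HarnessLib

/-!
# Route «BalabanUVNodes» (K4 «SpineRates»), node N15 = NE2, -a lane, part 19: THE MATRIX OF THE (1.65) OPERATOR `Δ_k` IS THE (1.66)
# BOND-BASIS MATRIX `deltaPol` — `Re Δ_k((z,κ),(y,λ)) = deltaPol M n ((rep z,κ),(rep y,λ))` (polarisation of (1.65) = (1.66)), so that the
# tree's DECAY (`B5Kernel166Decay.kernelDecay166`) and two-lattice RATE (`T4Cov2156Rate.kernelRate166`) of `deltaPol` ARE those of `Δ_k`'s entries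

Cell `pub-ymgap`, seat `pub-ymgap-dag-n15-a` (KNIT-BY-NAME, generation g4; HUMAN RULING D-0062; chair R424 venue; `bears_on: R4∕N15`).  Filed
`--supports stmt-QuantumFields-19351` (helper).  One plumbing def (`sesq166`, the sesquilinear (1.66) form) + theorems; imports BY NAME: β cell
`Beta.BlockEffectiveAction.DelK` ((1.65)), pv16 `B5Hk163Form166.DelK_form_eq_formDk` (`Bᴴ·Δ_k·B = formDk B`, (1.65) = (1.66)), pv15
`B5Bounds167Lattice.formDk`∕`curlHat`∕`w166` ((1.66) typed), b06 `B6Cov2156Torus.deltaPol`∕`phiC`∕`wgt`∕`ofBox` (the (1.66) polarisation matrix in the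
bond basis), b05-g9 `B5Kernel166Decay.ofBox_single` (basis dictionary).  Nothing in the tree is modified; nothing printed is a hypothesis.

WHY (part 18 `…N15LaplacianOfMinimizer`: `(Δ−∂∂*)·H_k = n^d·Q_kᴴ·Δ_k`).  The fourth (3.42) entry of the vector single-scale piece is thereby
`Q_kᴴ·(n^dΔ_k)·C^{(k)}·(η^{d+1}H_kᵀ)`; its η-defect in binder (a)'s format needs the uniform DECAY and the two-lattice RATE of `Δ_k`'s matrix entries.
Both are tree theorems — for the REAL bond-basis matrix `deltaPol M n` of the (1.66) FORM (`kernelDecay166`: `|Δ(b,b′)| ≤ c₀e^{−δ₀ρ_M}`;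
`kernelRate166`: `|Δ^{(Rn)}(b,b′) − Δ^{(n)}(b,b′)| ≤ θ₀n⁻¹e^{−δ₁ρ_M}`), which is also the `Δ_k` on which the piece's covariance `C^{(k)} = C(C*Δ_kC)⁻¹C*`
is built (parts 9∕15: `bondReductionT L M (deltaPol M n)`).  THIS FILE identifies the two typings: the β cell's OPERATOR `DelK` (defined through `H_k`)
has matrix entries whose real parts are `deltaPol`'s — by POLARISATION of the printed identity (1.65) = (1.66) (`DelK_form_eq_formDk`), no Fourier
computation redone.

CONTENTS.  §1 `sesq166 M n B′ B := Σ_{(μ,ν),t} ½w166_{μν}(p′_t)·conj((∂₁B′)~_{μν}(t))·(∂₁B)~_{μν}(t)` and its sesquilinearity (`hat`∕`curlHat` are linear: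
`hat_add`, `hat_smul`, `curlHat_add`, `curlHat_smul`; `sesq166_add_left∕_right`, `sesq166_smul_left∕_right`); `sesq166_self` (`= formDk`, the diagonal).
§2 `polarization_sesq` (two sesquilinear functions on a complex module agreeing on the diagonal agree), **`star_dotProduct_DelK`** (`B′ᴴ·Δ_k·B = sesq166 B′ B`
for ALL `B′, B`), `DelK_apply_eq_sesq166` (entries).  §3 the bond-basis dictionary: `ofRealCfg_ofBox_single`, `deltaPol_eq_re_sesq166`,
**`deltaPol_eq_re_DelK`** (`deltaPol M n p q = Re Δ_k((p̄₁,p₂),(q̄₁,q₂))`) and **`re_DelK_eq_deltaPol`** (`Re Δ_k((z,κ),(y,λ)) = deltaPol M n ((rep z,κ),(rep y,λ))`).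

HONEST FRAMING ∕ LIMITS.  `U = 1` linear theory on finite tori; identities only (the estimates are the cited tree theorems, not restated); the imaginary parts
of `Δ_k`'s entries are not discussed (the -a chain reads real parts, as parts 8–17); count-neutral (typed 28∕28 · discharged unchanged); NOT a discharge of N15;
one finite T⁴ at fixed ε — NOT infinite volume, NOT OS on ℝ⁴, NOT a mass gap, NOT Clay.
-/

noncomputable section

open scoped BigOperators ComplexConjugate
open Finset Matrix

namespace Summit.QuantumFields.YangMills.BalabanUVNodes.N15.VectorPiece

open Literature.MathematicalPhysics.QuantumFieldTheory.Balaban1983to89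
open Literature.MathematicalPhysics.QuantumFieldTheory.Balaban1983to89.B5Prop11Plancherel (Tor dft sOf)
open Literature.MathematicalPhysics.QuantumFieldTheory.Balaban1983to89.B5Bounds167Lattice (comp hat curlHat formDk w166 ofRealCfg)
open Literature.MathematicalPhysics.QuantumFieldTheory.Balaban1983to89.B6Cov2156Torus (deltaPol phiC wgt ofBox)
open Literature.MathematicalPhysics.QuantumFieldTheory.Balaban1983to89.B6LowerBound2153Torus (toT rep toT_rep rep_mem_pbox)
open Literature.MathematicalPhysics.QuantumFieldTheory.Balaban1983to89.B6Lemma24Torus (pbox)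
open Literature.MathematicalPhysics.QuantumFieldTheory.Balaban1983to89.B5Hk163Form166 (DelK_form_eq_formDk)
open Literature.MathematicalPhysics.QuantumFieldTheory.Balaban1983to89.B5Kernel166Decay (ofBox_single)
open Literature.MathematicalPhysics.QuantumFieldTheory.Balaban1983to89.Beta.BlockEffectiveAction (DelK)

variable {d : ℕ} (M : Fin d → ℕ) [hM : ∀ μ, NeZero (M μ)] (n : ℕ)

/-! ## §1 The sesquilinear (1.66) form and the diagonal -/

/-- THE SESQUILINEAR (1.66) FORM `Σ_{(μ,ν),t} ½w166_{μν}(p′_t)·conj((∂₁B′)~_{μν}(t))·(∂₁B)~_{μν}(t)` — the polarisation of `formDk` (conjugate-linear in `B′`,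
linear in `B`). [cite: Balaban1984PropagatorsI, (1.66) p.29] -/
def sesq166 (B' B : Tor M × Fin d → ℂ) : ℂ :=
  ∑ j : (Fin d × Fin d) × Tor M, ((wgt M n j : ℝ) : ℂ) * (conj (curlHat M B' j.1.1 j.1.2 j.2) * curlHat M B j.1.1 j.1.2 j.2)

/-- `B̃` is additive. [folklore] -/
theorem hat_add (B₁ B₂ : Tor M × Fin d → ℂ) (ν : Fin d) (t : Tor M) : hat M (B₁ + B₂) ν t = hat M B₁ ν t + hat M B₂ ν t := by
  show (dft M *ᵥ comp M (B₁ + B₂) ν) t = (dft M *ᵥ comp M B₁ ν) t + (dft M *ᵥ comp M B₂ ν) t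
  rw [show comp M (B₁ + B₂) ν = comp M B₁ ν + comp M B₂ ν from rfl, Matrix.mulVec_add, Pi.add_apply]

/-- `B̃` is homogeneous. [folklore] -/
theorem hat_smul (c : ℂ) (B : Tor M × Fin d → ℂ) (ν : Fin d) (t : Tor M) : hat M (c • B) ν t = c * hat M B ν t := by
  show (dft M *ᵥ comp M (c • B) ν) t = c * (dft M *ᵥ comp M B ν) t
  rw [show comp M (c • B) ν = c • comp M B ν from rfl, Matrix.mulVec_smul, Pi.smul_apply, smul_eq_mul]

/-- `(∂₁B)~` is additive. [folklore] -/
theorem curlHat_add (B₁ B₂ : Tor M × Fin d → ℂ) (μ ν : Fin d) (t : Tor M) :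
    curlHat M (B₁ + B₂) μ ν t = curlHat M B₁ μ ν t + curlHat M B₂ μ ν t := by
  simp only [curlHat, hat_add]; ring

/-- `(∂₁B)~` is homogeneous. [folklore] -/
theorem curlHat_smul (c : ℂ) (B : Tor M × Fin d → ℂ) (μ ν : Fin d) (t : Tor M) :
    curlHat M (c • B) μ ν t = c * curlHat M B μ ν t := by
  simp only [curlHat, hat_smul]; ring

/-- Additivity in the first slot. [folklore] -/
theorem sesq166_add_left (B₁ B₂ B : Tor M × Fin d → ℂ) : sesq166 M n (B₁ + B₂) B = sesq166 M n B₁ B + sesq166 M n B₂ B := by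
  simp only [sesq166, curlHat_add, map_add, ← Finset.sum_add_distrib]
  exact Finset.sum_congr rfl fun j _ => by ring

/-- Additivity in the second slot. [folklore] -/
theorem sesq166_add_right (B' B₁ B₂ : Tor M × Fin d → ℂ) : sesq166 M n B' (B₁ + B₂) = sesq166 M n B' B₁ + sesq166 M n B' B₂ := by
  simp only [sesq166, curlHat_add, ← Finset.sum_add_distrib]
  exact Finset.sum_congr rfl fun j _ => by ring

/-- Conjugate-homogeneity in the first slot. [folklore] -/
theorem sesq166_smul_left (c : ℂ) (B' B : Tor M × Fin d → ℂ) : sesq166 M n (c • B') B = conj c * sesq166 M n B' B := by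
  simp only [sesq166, curlHat_smul, map_mul, Finset.mul_sum]
  exact Finset.sum_congr rfl fun j _ => by ring

/-- Homogeneity in the second slot. [folklore] -/
theorem sesq166_smul_right (c : ℂ) (B' B : Tor M × Fin d → ℂ) : sesq166 M n B' (c • B) = c * sesq166 M n B' B := by
  simp only [sesq166, curlHat_smul, Finset.mul_sum]
  exact Finset.sum_congr rfl fun j _ => by ring

/-- THE DIAGONAL IS (1.66): `sesq166 B B = formDk B` (`conj z·z = |z|²`). [cite: Balaban1984PropagatorsI, (1.66) p.29] -/
theorem sesq166_self [NeZero n] (B : Tor M × Fin d → ℂ) : sesq166 M n B B = ((formDk n M B : ℝ) : ℂ) := by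
  unfold sesq166 formDk wgt
  rw [Fintype.sum_prod_type, Fintype.sum_prod_type]
  push_cast
  rw [Finset.mul_sum]
  refine Finset.sum_congr rfl fun μ _ => ?_
  rw [Finset.mul_sum]
  refine Finset.sum_congr rfl fun ν _ => ?_
  rw [Finset.mul_sum]
  refine Finset.sum_congr rfl fun t _ => ?_
  rw [Complex.conj_mul' (curlHat M B μ ν t)]
  ring

/-! ## §2 Polarisation: `B′ᴴ·Δ_k·B` IS the sesquilinear (1.66) form -/

omit hM in
/-- POLARISATION: two functions on a complex module that are additive and (conjugate-)homogeneous in their two slots and agree on the diagonal agree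
everywhere (`4S(x,y) = S(x+y,x+y) − S(x−y,x−y) − i·S(x+iy,x+iy) + i·S(x−iy,x−iy)`). [folklore] -/
theorem polarization_sesq {V : Type} [AddCommGroup V] [Module ℂ V] (S T : V → V → ℂ)
    (hSa₁ : ∀ x y z, S (x + y) z = S x z + S y z) (hSa₂ : ∀ x y z, S x (y + z) = S x y + S x z)
    (hSc₁ : ∀ (c : ℂ) x y, S (c • x) y = conj c * S x y) (hSc₂ : ∀ (c : ℂ) x y, S x (c • y) = c * S x y)
    (hTa₁ : ∀ x y z, T (x + y) z = T x z + T y z) (hTa₂ : ∀ x y z, T x (y + z) = T x y + T x z)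
    (hTc₁ : ∀ (c : ℂ) x y, T (c • x) y = conj c * T x y) (hTc₂ : ∀ (c : ℂ) x y, T x (c • y) = c * T x y)
    (hdiag : ∀ v, S v v = T v v) (x y : V) : S x y = T x y := by
  -- `Q(x + c•y) = Q x + c·S x y + conj c·S y x + conj c·c·S y y`
  have expand : ∀ (R : V → V → ℂ), (∀ x y z, R (x + y) z = R x z + R y z) → (∀ x y z, R x (y + z) = R x y + R x z) →
      (∀ (c : ℂ) x y, R (c • x) y = conj c * R x y) → (∀ (c : ℂ) x y, R x (c • y) = c * R x y) →
      ∀ c : ℂ, R (x + c • y) (x + c • y) = R x x + c * R x y + conj c * R y x + conj c * c * R y y := by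
    intro R ha₁ ha₂ hc₁ hc₂ c
    rw [ha₁, ha₂, ha₂, hc₂, hc₁, hc₁, hc₂]
    ring
  have hS := expand S hSa₁ hSa₂ hSc₁ hSc₂
  have hT := expand T hTa₁ hTa₂ hTc₁ hTc₂
  have key : ∀ (R : V → V → ℂ), (∀ c : ℂ, R (x + c • y) (x + c • y) = R x x + c * R x y + conj c * R y x + conj c * c * R y y) →
      4 * R x y = R (x + (1 : ℂ) • y) (x + (1 : ℂ) • y) - R (x + (-1 : ℂ) • y) (x + (-1 : ℂ) • y)
        - Complex.I * R (x + Complex.I • y) (x + Complex.I • y) + Complex.I * R (x + (-Complex.I) • y) (x + (-Complex.I) • y) := by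
    intro R hR
    rw [hR, hR, hR, hR, map_one, map_neg, map_one, map_neg, Complex.conj_I]
    linear_combination (2 * R x y - 2 * R y x) * Complex.I_sq
  have h4 : (4 : ℂ) * S x y = 4 * T x y := by
    rw [key S hS, key T hT, hdiag, hdiag, hdiag, hdiag]
  exact mul_left_cancel₀ (by norm_num) h4

/-- **`B′ᴴ·Δ_k·B = sesq166 B′ B` FOR ALL `B′, B`**: the polarisation of (1.65) = (1.66) (`B5Hk163Form166.DelK_form_eq_formDk` on the diagonal).
[cite: Balaban1984PropagatorsI, (1.65)–(1.66) p.29] -/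
theorem star_dotProduct_DelK [NeZero n] (hn : 1 ≤ n) {a : ℝ} (ha : 0 < a) (B' B : Tor M × Fin d → ℂ) :
    star B' ⬝ᵥ (DelK n hn M a ha *ᵥ B) = sesq166 M n B' B := by
  refine polarization_sesq (fun B' B => star B' ⬝ᵥ (DelK n hn M a ha *ᵥ B)) (sesq166 M n)
    (fun x y z => by simp only [star_add, add_dotProduct])
    (fun x y z => by simp only [Matrix.mulVec_add, dotProduct_add])
    (fun c x y => by simp only [star_smul, smul_dotProduct, smul_eq_mul, Complex.star_def])
    (fun c x y => by simp only [Matrix.mulVec_smul, dotProduct_smul, smul_eq_mul])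
    (sesq166_add_left M n) (sesq166_add_right M n) (sesq166_smul_left M n) (sesq166_smul_right M n)
    (fun v => ?_) B' B
  rw [DelK_form_eq_formDk, sesq166_self]

/-- The ENTRIES of `Δ_k`: `Δ_k(i, j) = sesq166 eᵢ eⱼ`. [cite: Balaban1984PropagatorsI, (1.65)–(1.66) p.29] -/
theorem DelK_apply_eq_sesq166 [NeZero n] (hn : 1 ≤ n) {a : ℝ} (ha : 0 < a) (i j : Tor M × Fin d) :
    DelK n hn M a ha i j = sesq166 M n (Pi.single (M := fun _ => ℂ) i 1) (Pi.single (M := fun _ => ℂ) j 1) := by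
  classical
  rw [← star_dotProduct_DelK M n hn ha]
  have hs : star (Pi.single (M := fun _ => ℂ) i 1) = Pi.single (M := fun _ => ℂ) i 1 := by
    ext k; by_cases hk : k = i <;> simp [hk]
  rw [hs, single_dotProduct, one_mul, Matrix.mulVec_single_one]
  rfl

/-! ## §3 The bond-basis dictionary: `deltaPol = Re Δ_k` -/

/-- The complexified box indicator of a bond IS the basis vector of the torus bond. [folklore] -/
theorem ofRealCfg_ofBox_single (p : B4.Idx (pbox M) d) :
    ofRealCfg M (ofBox M (Pi.single p (1 : ℝ))) = Pi.single (M := fun _ => ℂ) ((toT M (p.1 : Fin d → ℤ), p.2)) 1 := by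
  classical
  funext x
  obtain ⟨x₁, ν⟩ := x
  show ((ofBox M (Pi.single p (1 : ℝ)) (x₁, ν) : ℝ) : ℂ) = _
  rw [ofBox_single]
  by_cases h : x₁ = toT M (p.1 : Fin d → ℤ) ∧ ν = p.2
  · rw [if_pos h]
    obtain ⟨rfl, rfl⟩ := h
    simp
  · rw [if_neg h]
    have hne : ((x₁, ν) : Tor M × Fin d) ≠ (toT M (p.1 : Fin d → ℤ), p.2) := fun heq => h (Prod.mk.inj heq)
    simp [hne]

/-- `deltaPol` IS the real part of the sesquilinear form on the bond indicators (by definition of `deltaPol`∕`phiC`). [cite: Balaban1984PropagatorsI, (1.66) p.29] -/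
theorem deltaPol_eq_re_sesq166 (p q : B4.Idx (pbox M) d) :
    deltaPol M n p q = (sesq166 M n (ofRealCfg M (ofBox M (Pi.single p 1))) (ofRealCfg M (ofBox M (Pi.single q 1)))).re := by
  unfold deltaPol sesq166 phiC
  rw [Complex.re_sum]
  exact Finset.sum_congr rfl fun j _ => by rw [Complex.re_ofReal_mul]

/-- **`deltaPol M n p q = Re Δ_k((p̄₁, p₂), (q̄₁, q₂))`** — the (1.66) bond-basis matrix IS the real part of the (1.65) operator's matrix.
[cite: Balaban1984PropagatorsI, (1.65)–(1.66) p.29] -/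
theorem deltaPol_eq_re_DelK [NeZero n] (hn : 1 ≤ n) {a : ℝ} (ha : 0 < a) (p q : B4.Idx (pbox M) d) :
    deltaPol M n p q = (DelK n hn M a ha (toT M (p.1 : Fin d → ℤ), p.2) (toT M (q.1 : Fin d → ℤ), q.2)).re := by
  rw [deltaPol_eq_re_sesq166, ofRealCfg_ofBox_single, ofRealCfg_ofBox_single, DelK_apply_eq_sesq166 M n hn ha]

/-- **`Re Δ_k((z,κ),(y,λ)) = deltaPol M n ((rep z, κ), (rep y, λ))`** — torus coordinates (`toT (rep z) = z`). [cite: Balaban1984PropagatorsI, (1.65)–(1.66) p.29] -/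
theorem re_DelK_eq_deltaPol [NeZero n] (hn : 1 ≤ n) {a : ℝ} (ha : 0 < a) (z y : Tor M) (κ lam : Fin d) :
    (DelK n hn M a ha (z, κ) (y, lam)).re = deltaPol M n (⟨rep M z, rep_mem_pbox M z⟩, κ) (⟨rep M y, rep_mem_pbox M y⟩, lam) := by
  rw [deltaPol_eq_re_DelK M n hn ha]
  simp only [toT_rep]

end Summit.QuantumFields.YangMills.BalabanUVNodes.N15.VectorPiece
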